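import Mathlib
import Literature.Analysis.FluidPDE.VectorCalculus
import Literature.Analysis.FluidPDE.TaoAveragedNondegeneracy
import Summits.NavierStokesRegularity.NavierStokesRegularity.Theorems.FilamentSkeletonRssSkeletonEquilibriumStraightSkeletonSlip

/-!
# Axial strain of a straight skeleton along a straight filament; the `K ≤ 0` slice of
`stub_nearVerticalSubcritical`
(helper for the registered stub `stub_nearVerticalSubcritical` of crux `FilamentSkeletonRss.SkeletonEquilibrium`,
stmt-NavierStokesRegularity-15400; negation line `kelvin-sonic-negation`; companion of
`…StraightFilamentRigidity` which slices the other two s1 stubs at `K ≤ 0`)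

For `K ≤ 0` every witness of the crux's clauses is a configuration of straight unit-speed lines
`Ξ k σ = a_k + σ e_k` (`StraightFilament.straight_of_curvature_clause`). Along the straight filament `j`
the slip is then EXPLICIT: re-basing every line `k` at the foot `a_k′` of the perpendicular from the point
`x = Ξ j τs` (translation invariance of the line integral + the closed form `Sketch.stub_lineBiotSavart`),
`w_j(τ) = Σ_k (Γγ_k/4π) · β_k · 2/(D_k(τ) + 1) + const + τ/2`, with `β_k = ⟪e_k × q_k, e_j⟫`,
`q_k = x − a_k′ ⊥ e_k`, `‖q_k‖ = dist(x, line k)` and `D_k(τ) = ‖q_k + (τ−τs)e_j‖² − ⟪q_k + (τ−τs)e_j, e_k⟫²`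
(`slip_formula_straight`). Differentiating at `τs` (`hasDerivAt_slip_straight`):
`w_j′(τs) = ½ − Σ_k (Γγ_k/4π) β_k · 4⟪q_k, e_j⟫/(‖q_k‖² + 1)²`, and each term is
`≤ 4|Γγ_k/4π| · ‖e_j × e_k‖ · ‖q_k‖²/(‖q_k‖²+1)²` (`|β_k| ≤ ‖q_k‖`, `|⟪q_k, e_j⟫| ≤ ‖e_j × e_k‖ ‖q_k‖` since
`q_k ⊥ e_k`). With the stub's near-verticality hypothesis (relative tilt `≤ 3θ` for lines within `R√Γ`),
separation (`‖q_k‖ ≥ ρ√Γ`, `k ≠ j`) and `‖q_k‖ > R√Γ` otherwise this gives the registered statement of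
`stub_nearVerticalSubcritical` with the single extra hypothesis `K ≤ 0` and the explicit constant
`C = (Σ_k |γ_k|)/π · (3/ρ² + 1)` (`nearVerticalSubcritical_of_nonposK`; no `α ≠ 0` needed, the self term
vanishes identically for a straight filament). This is the straight-class certificate of the s1 card's
mechanism "axial strain of near-vertical near-parallel filaments is `O(θ)` in the ball and `O(1/R²)` from
outside"; for `K > 0` the missing input is control of the curved SELF-strand term (fsrs-4/6 DIAGs).
No summit statement is proved; NS regularity is not touched.
-/

noncomputable section

open Set Filter Topology MeasureTheory
open Literature.Analysis.FluidPDE Literature.Analysis.FluidPDE.Tao2016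
open scoped RealInnerProductSpace InnerProductSpace

namespace Summit.NavierStokesRegularity.NavierStokesRegularity.Theorems.SkeletonEquilibrium.StraightFilament
set_option linter.dupNamespace false

/-! ## Private tilt algebra (copies; the landed originals live in `…TameVerticalToolsA`, outside the
current farm build closure, and in `…StraightSkeletonSlip` as private declarations) -/

/-- `‖v × w‖ ≤ ‖v‖ ‖w‖`. [folklore] -/
private theorem norm_cross_le_norms (v w : EuclideanSpace ℝ (Fin 3)) : ‖cross v w‖ ≤ ‖v‖ * ‖w‖ := by
  rw [norm_cross]
  exact mul_le_of_le_one_right (mul_nonneg (norm_nonneg _) (norm_nonneg _)) (Real.sin_le_one _)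

/-- Lagrange: for a UNIT vector `e`, `‖a − ⟪a,e⟫e‖ = ‖a × e‖`. [folklore] -/
private theorem norm_sub_proj_eq_norm_cross_unit (a e : EuclideanSpace ℝ (Fin 3)) (he : ‖e‖ = 1) :
    ‖a - ⟪a, e⟫ • e‖ = ‖cross a e‖ := by
  have h1 : ‖a - ⟪a, e⟫ • e‖ ^ 2 = ‖a‖ ^ 2 - ⟪a, e⟫ ^ 2 := by
    rw [← real_inner_self_eq_norm_sq, inner_sub_left, inner_sub_right, inner_sub_right,
      real_inner_smul_left, real_inner_smul_right, real_inner_smul_left, real_inner_smul_right,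
      real_inner_self_eq_norm_sq, real_inner_self_eq_norm_sq, he, real_inner_comm e a]
    ring
  have h2 : ‖cross a e‖ ^ 2 = ‖a‖ ^ 2 - ⟪a, e⟫ ^ 2 := by
    rw [norm_cross_sq, he]; ring
  have h3 : ‖a - ⟪a, e⟫ • e‖ ^ 2 = ‖cross a e‖ ^ 2 := by rw [h1, h2]
  exact (pow_left_inj₀ (norm_nonneg _) (norm_nonneg _) two_ne_zero).1 h3

/-- Relative tilt of two near-vertical unit vectors: `‖a × e‖, ‖b × e‖ ≤ θ` (unit `a, b, e`) give
`‖a × b‖ ≤ 2θ + θ²`. [folklore] -/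
private theorem norm_cross_le_of_near_vertical (a b e : EuclideanSpace ℝ (Fin 3)) (ha : ‖a‖ = 1)
    (hb : ‖b‖ = 1) (he : ‖e‖ = 1) {θ : ℝ} (hae : ‖cross a e‖ ≤ θ) (hbe : ‖cross b e‖ ≤ θ) :
    ‖cross a b‖ ≤ 2 * θ + θ ^ 2 := by
  set a' := a - ⟪a, e⟫ • e with ha'
  set b' := b - ⟪b, e⟫ • e with hb'
  have hna' : ‖a'‖ ≤ θ := by rw [ha', norm_sub_proj_eq_norm_cross_unit a e he]; exact hae
  have hnb' : ‖b'‖ ≤ θ := by rw [hb', norm_sub_proj_eq_norm_cross_unit b e he]; exact hbe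
  have hθ : 0 ≤ θ := le_trans (norm_nonneg _) hae
  have hca : |⟪a, e⟫| ≤ 1 := by
    have := abs_real_inner_le_norm a e; rw [ha, he, one_mul] at this; exact this
  have hcb : |⟪b, e⟫| ≤ 1 := by
    have := abs_real_inner_le_norm b e; rw [hb, he, one_mul] at this; exact this
  have hdec : cross a b = ⟪a, e⟫ • cross e b' + ⟪b, e⟫ • cross a' e + cross a' b' := by
    rw [ha', hb']
    ext i
    fin_cases i <;> simp [cross_apply_zero, cross_apply_one, cross_apply_two] <;> ring
  calc ‖cross a b‖ = ‖⟪a, e⟫ • cross e b' + ⟪b, e⟫ • cross a' e + cross a' b'‖ := by rw [hdec]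
    _ ≤ ‖⟪a, e⟫ • cross e b'‖ + ‖⟪b, e⟫ • cross a' e‖ + ‖cross a' b'‖ := norm_add₃_le
    _ ≤ 1 * (1 * θ) + 1 * (θ * 1) + θ * θ := by
        gcongr
        · rw [norm_smul, Real.norm_eq_abs]
          exact mul_le_mul hca ((norm_cross_le_norms e b').trans (by rw [he]; gcongr)) (norm_nonneg _)
            zero_le_one
        · rw [norm_smul, Real.norm_eq_abs]
          exact mul_le_mul hcb ((norm_cross_le_norms a' e).trans (by rw [he]; gcongr)) (norm_nonneg _)
            zero_le_one
        · exact (norm_cross_le_norms a' b').trans (mul_le_mul hna' hnb' (norm_nonneg _) hθ)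
    _ = 2 * θ + θ ^ 2 := by ring

/-! ## The registered stub `stub_nearVerticalSubcritical`, `K ≤ 0` slice -/

/-- **`stub_nearVerticalSubcritical`, `K ≤ 0` slice.** The registered statement of
`stub_nearVerticalSubcritical` with the single extra hypothesis `K ≤ 0` (inserted after `0 < C₀`) and the
explicit constant `C = (Σ_k |γ_k|)/π · (3/ρ² + 1)`: for a straight skeleton the axial strain at a
stagnation point of filament `j` is the finite sum of the other lines' strains (the self term vanishes),
each `≤ 3|γ_k|θ/(πρ²)` for a line within `R√Γ` (relative tilt `≤ 3θ`, separation `ρ√Γ`) and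
`≤ |γ_k|/(πR²)` for a line farther than `R√Γ`. No `α ≠ 0`, length-regularity, integrability or
unique-zero input is used. [folklore] -/
theorem nearVerticalSubcritical_of_nonposK :
    ∀ (N : ℕ) (γ : Fin N → ℝ) (α ρ K C₀ : ℝ), 0 < ρ → 0 < C₀ → K ≤ 0 → ∃ C : ℝ, 0 ≤ C ∧
      ∀ (θ R Γ : ℝ), 0 < θ → θ ≤ 1 → 1 ≤ R → 1 ≤ Γ →
        ∀ (Ξ : Fin N → ℝ → EuclideanSpace ℝ (Fin 3)) (w : Fin N → ℝ → ℝ),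
          (∀ j, ContDiff ℝ 2 (Ξ j) ∧ Function.Injective (Ξ j) ∧ Differentiable ℝ (w j) ∧
              (∀ τ, ‖deriv (Ξ j) τ‖ = 1) ∧ (∀ τ, ‖iteratedDeriv 2 (Ξ j) τ‖ * Real.sqrt Γ ≤ K) ∧
              Tendsto (fun τ => ‖Ξ j τ‖) atTop atTop ∧ Tendsto (fun τ => ‖Ξ j τ‖) atBot atTop) →
          (∀ j k, j ≠ k → ∀ τ σ, ρ * Real.sqrt Γ ≤ ‖Ξ j τ - Ξ k σ‖) →
          (∀ j (x : EuclideanSpace ℝ (Fin 3)), Integrable (fun σ : ℝ =>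
              ((‖x - Ξ j σ‖ ^ 2 + 1) ^ (3 / 2 : ℝ))⁻¹ • cross (deriv (Ξ j) σ) (x - Ξ j σ))) →
          (∀ j τ, (∑ k : Fin N, (Γ * γ k / (4 * Real.pi)) • ∫ σ : ℝ,
                ((‖Ξ j τ - Ξ k σ‖ ^ 2 + 1) ^ (3 / 2 : ℝ))⁻¹ • cross (deriv (Ξ k) σ) (Ξ j τ - Ξ k σ))
              + (1 / 2 : ℝ) • Ξ j τ - α • cross (EuclideanSpace.single (2 : Fin 3) (1 : ℝ)) (Ξ j τ)
              = w j τ • deriv (Ξ j) τ) →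
          (∀ (k : Fin N) (x : EuclideanSpace ℝ (Fin 3)) (D : ℝ), Real.sqrt Γ ≤ D →
              volume {τ : ℝ | ‖Ξ k τ - x‖ ≤ D} ≤ ENNReal.ofReal (C₀ * D)) →
          ∀ (j : Fin N) (τs : ℝ), w j τs = 0 →
            (∀ (k : Fin N) (τ : ℝ), ‖Ξ k τ - Ξ j τs‖ ≤ R * Real.sqrt Γ →
                ‖cross (deriv (Ξ k) τ) (EuclideanSpace.single (2 : Fin 3) (1 : ℝ))‖ ≤ θ) →
            deriv (w j) τs ≤ 1 / 2 + C * (θ + 1 / R) := by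
  intro N γ α ρ K C₀ hρ _ hK
  refine ⟨(∑ k : Fin N, |γ k|) / Real.pi * (3 / ρ ^ 2 + 1), by positivity, ?_⟩
  intro θ R Γ hθ hθ1 hR hΓ Ξ w hcl hsep _ heq _ j τs _ hvert
  have hΓ0 : 0 < Γ := by linarith
  have hR0 : 0 < R := by linarith
  have hsq : 0 < Real.sqrt Γ := Real.sqrt_pos.2 hΓ0
  have hne₃ : ‖(EuclideanSpace.single (2 : Fin 3) (1 : ℝ))‖ = 1 := by simp
  -- straightness: `Ξ k σ = a k + σ • e k`
  have hstr : ∀ k, (∀ τ, deriv (Ξ k) τ = deriv (Ξ k) 0) ∧ (∀ τ, Ξ k τ = Ξ k 0 + τ • deriv (Ξ k) 0) :=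
    fun k => straight_of_curvature_clause (hcl k).1 hΓ0 hK (hcl k).2.2.2.2.1
  obtain ⟨a, ha⟩ : ∃ a : Fin N → EuclideanSpace ℝ (Fin 3), ∀ k, a k = Ξ k 0 := ⟨_, fun _ => rfl⟩
  obtain ⟨e, hee⟩ : ∃ e : Fin N → EuclideanSpace ℝ (Fin 3), ∀ k, e k = deriv (Ξ k) 0 :=
    ⟨_, fun _ => rfl⟩
  have he : ∀ k, ‖e k‖ = 1 := fun k => by rw [hee k]; exact (hcl k).2.2.2.1 0
  have hline : ∀ k σ, Ξ k σ = a k + σ • e k := fun k σ => by rw [ha k, hee k]; exact (hstr k).2 σ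
  have hder : ∀ k σ, deriv (Ξ k) σ = e k := fun k σ => by rw [hee k]; exact (hstr k).1 σ
  -- the stagnation point `x`, the feet `a k + s k • e k`, `q k = x - foot ⊥ e k`
  obtain ⟨x, hx⟩ : ∃ x : EuclideanSpace ℝ (Fin 3), x = a j + τs • e j := ⟨_, rfl⟩
  have hxj : Ξ j τs = x := by rw [hx]; exact hline j τs
  obtain ⟨s, hs⟩ : ∃ s : Fin N → ℝ, ∀ k, s k = ⟪x - a k, e k⟫ := ⟨_, fun _ => rfl⟩
  obtain ⟨q, hq⟩ : ∃ q : Fin N → EuclideanSpace ℝ (Fin 3), ∀ k, q k = x - (a k + s k • e k) :=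
    ⟨_, fun _ => rfl⟩
  have hqe : ∀ k, ⟪q k, e k⟫ = 0 := fun k => by
    rw [hq k, hs k]; exact inner_foot_eq_zero (a k) (e k) x (he k)
  have hdist : ∀ k, ‖Ξ k (s k) - Ξ j τs‖ = ‖q k‖ := by
    intro k
    rw [hline k (s k), hxj, ← norm_neg, hq k]
    congr 1
    abel
  have hqj : q j = 0 := by
    have h1 : s j = τs := by
      rw [hs j, hx, add_sub_cancel_left, real_inner_smul_left, real_inner_self_eq_norm_sq, he j]
      ring
    rw [hq j, h1, hx, sub_self]
  obtain ⟨D, hD⟩ : ∃ D : Fin N → ℝ → ℝ, ∀ k τ,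
      D k τ = ‖q k + (τ - τs) • e j‖ ^ 2 - (inner ℝ (q k + (τ - τs) • e j) (e k)) ^ 2 :=
    ⟨_, fun _ _ => rfl⟩
  have hD0 : ∀ k, D k τs = ‖q k‖ ^ 2 := by
    intro k
    rw [hD k τs, sub_self, zero_smul, add_zero, hqe k]
    ring
  -- the explicit slip and its derivative at `τs`
  have hslip := slip_formula_straight Γ γ α a e he hline hder j (heq j) τs q
    (fun k => by rw [hq k, hs k, hx]) D hD
  have hwfun : w j = fun τ => (∑ k : Fin N, Γ * γ k / (4 * Real.pi) *
      (2 / (D k τ + 1) * ⟪cross (e k) (q k), e j⟫))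
      + (1 / 2 * ⟪a j, e j⟫ - α * ⟪cross (EuclideanSpace.single (2 : Fin 3) (1 : ℝ)) (a j), e j⟫)
      + τ / 2 := funext hslip
  have hDer : ∀ k, HasDerivAt (D k) (2 * ⟪q k, e j⟫ - 2 * ⟪q k, e k⟫ * ⟪e j, e k⟫) τs := by
    intro k
    have hfun : D k = fun τ => ‖q k + (τ - τs) • e j‖ ^ 2 - (inner ℝ (q k + (τ - τs) • e j) (e k)) ^ 2 :=
      funext (hD k)
    rw [hfun]
    exact hasDerivAt_lineDist (q k) (e j) (e k) τs
  have hD1 : ∀ k, D k τs + 1 ≠ 0 := fun k => by rw [hD0 k]; positivity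
  have hderiv : deriv (w j) τs = (∑ k : Fin N, Γ * γ k / (4 * Real.pi) *
      (-(2 * (2 * ⟪q k, e j⟫ - 2 * ⟪q k, e k⟫ * ⟪e j, e k⟫)) / (D k τs + 1) ^ 2 *
        ⟪cross (e k) (q k), e j⟫)) + 1 / 2 := by
    rw [hwfun]
    exact (hasDerivAt_slip_straight (fun k => Γ * γ k / (4 * Real.pi))
      (fun k => ⟪cross (e k) (q k), e j⟫) (fun k => 2 * ⟪q k, e j⟫ - 2 * ⟪q k, e k⟫ * ⟪e j, e k⟫)
      D _ τs hDer hD1).deriv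
  have hterm : ∀ k, Γ * γ k / (4 * Real.pi) *
      (-(2 * (2 * ⟪q k, e j⟫ - 2 * ⟪q k, e k⟫ * ⟪e j, e k⟫)) / (D k τs + 1) ^ 2 *
        ⟪cross (e k) (q k), e j⟫)
      = Γ * γ k / (4 * Real.pi) *
        (-(2 * (2 * ⟪q k, e j⟫)) / (‖q k‖ ^ 2 + 1) ^ 2 * ⟪cross (e k) (q k), e j⟫) := by
    intro k
    rw [hqe k, hD0 k]
    ring
  -- per-strand bound
  have hck : ∀ k, |Γ * γ k / (4 * Real.pi)| = Γ * |γ k| / (4 * Real.pi) := by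
    intro k
    rw [abs_div, abs_mul, abs_of_pos hΓ0, abs_of_pos (by positivity : (0 : ℝ) < 4 * Real.pi)]
  have htj : ‖cross (e j) (EuclideanSpace.single (2 : Fin 3) (1 : ℝ))‖ ≤ θ := by
    have h := hvert j τs (by rw [sub_self, norm_zero]; positivity)
    rwa [hder j τs] at h
  have hbound : ∀ k, |Γ * γ k / (4 * Real.pi) *
      (-(2 * (2 * ⟪q k, e j⟫)) / (‖q k‖ ^ 2 + 1) ^ 2 * ⟪cross (e k) (q k), e j⟫)|
        ≤ |γ k| / Real.pi * (3 * θ / ρ ^ 2 + 1 / R) := by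
    intro k
    have h1 := abs_strainTerm_le (e j) (e k) (q k) (he j) (he k) (hqe k) (Γ * γ k / (4 * Real.pi))
    have hRHS0 : 0 ≤ |γ k| / Real.pi * (3 * θ / ρ ^ 2 + 1 / R) := by positivity
    by_cases hnear : ‖q k‖ ≤ R * Real.sqrt Γ
    · -- a strand within `R√Γ`: relative tilt `≤ 3θ`
      have htk : ‖cross (e k) (EuclideanSpace.single (2 : Fin 3) (1 : ℝ))‖ ≤ θ := by
        have h := hvert k (s k) (by rw [hdist k]; exact hnear)
        rwa [hder k (s k)] at h
      have hrel : ‖cross (e j) (e k)‖ ≤ 3 * θ := by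
        have h := norm_cross_le_of_near_vertical (e j) (e k) _ (he j) (he k) hne₃ htj htk
        nlinarith
      by_cases hkj : k = j
      · -- the strand through the stagnation point itself: `q j = 0`, no self strain
        have hk0 : q k = 0 := by rw [hkj]; exact hqj
        rw [hk0, inner_zero_left, mul_zero, mul_zero, neg_zero, zero_div, zero_mul, mul_zero, abs_zero]
        exact hRHS0
      · have hsepk : ρ * Real.sqrt Γ ≤ ‖q k‖ := by
          have h := hsep j k (Ne.symm hkj) τs (s k)
          rwa [← norm_sub_rev, hdist k] at h
        have hq2 : ρ ^ 2 * Γ ≤ ‖q k‖ ^ 2 + 1 := by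
          have h2 := mul_self_le_mul_self (by positivity) hsepk
          have h3 : ρ * Real.sqrt Γ * (ρ * Real.sqrt Γ) = ρ ^ 2 * Γ := by
            rw [mul_mul_mul_comm, Real.mul_self_sqrt hΓ0.le]; ring
          nlinarith
        calc |Γ * γ k / (4 * Real.pi) *
              (-(2 * (2 * ⟪q k, e j⟫)) / (‖q k‖ ^ 2 + 1) ^ 2 * ⟪cross (e k) (q k), e j⟫)|
            ≤ |Γ * γ k / (4 * Real.pi)| * (4 * ‖cross (e j) (e k)‖ / (‖q k‖ ^ 2 + 1)) := h1
          _ ≤ (Γ * |γ k| / (4 * Real.pi)) * (4 * (3 * θ) / (ρ ^ 2 * Γ)) := by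
              rw [hck k]; gcongr
          _ = |γ k| / Real.pi * (3 * θ / ρ ^ 2) := by field_simp
          _ ≤ |γ k| / Real.pi * (3 * θ / ρ ^ 2 + 1 / R) := by
              gcongr; exact le_add_of_nonneg_right (by positivity)
    · -- a strand farther than `R√Γ`
      rw [not_le] at hnear
      have hq2 : R ^ 2 * Γ ≤ ‖q k‖ ^ 2 + 1 := by
        have h2 := mul_self_lt_mul_self (by positivity) hnear
        have h3 : R * Real.sqrt Γ * (R * Real.sqrt Γ) = R ^ 2 * Γ := by
          rw [mul_mul_mul_comm, Real.mul_self_sqrt hΓ0.le]; ring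
        nlinarith
      have hcr : ‖cross (e j) (e k)‖ ≤ 1 := by
        refine (norm_cross_le_norms _ _).trans ?_
        rw [he j, he k]; norm_num
      calc |Γ * γ k / (4 * Real.pi) *
            (-(2 * (2 * ⟪q k, e j⟫)) / (‖q k‖ ^ 2 + 1) ^ 2 * ⟪cross (e k) (q k), e j⟫)|
          ≤ |Γ * γ k / (4 * Real.pi)| * (4 * ‖cross (e j) (e k)‖ / (‖q k‖ ^ 2 + 1)) := h1
        _ ≤ (Γ * |γ k| / (4 * Real.pi)) * (4 * 1 / (R ^ 2 * Γ)) := by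
            rw [hck k]; gcongr
        _ = |γ k| / Real.pi * (1 / R ^ 2) := by field_simp
        _ ≤ |γ k| / Real.pi * (1 / R) := by
            have hRR : R ≤ R ^ 2 := by nlinarith [mul_le_mul_of_nonneg_left hR hR0.le]
            exact mul_le_mul_of_nonneg_left (div_le_div_of_nonneg_left zero_le_one hR0 hRR)
              (by positivity)
        _ ≤ |γ k| / Real.pi * (3 * θ / ρ ^ 2 + 1 / R) := by
            gcongr; exact le_add_of_nonneg_left (by positivity)
  -- sum up
  rw [hderiv, Finset.sum_congr rfl fun k _ => hterm k]
  have hsum : (∑ k : Fin N, Γ * γ k / (4 * Real.pi) *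
      (-(2 * (2 * ⟪q k, e j⟫)) / (‖q k‖ ^ 2 + 1) ^ 2 * ⟪cross (e k) (q k), e j⟫))
        ≤ ∑ k : Fin N, |γ k| / Real.pi * (3 * θ / ρ ^ 2 + 1 / R) :=
    Finset.sum_le_sum fun k _ => (le_abs_self _).trans (hbound k)
  have hC : (∑ k : Fin N, |γ k| / Real.pi * (3 * θ / ρ ^ 2 + 1 / R))
      ≤ (∑ k : Fin N, |γ k|) / Real.pi * (3 / ρ ^ 2 + 1) * (θ + 1 / R) := by
    rw [← Finset.sum_mul, ← Finset.sum_div]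
    have hγ : 0 ≤ (∑ k : Fin N, |γ k|) / Real.pi := by positivity
    have hmono : 3 * θ / ρ ^ 2 + 1 / R ≤ (3 / ρ ^ 2 + 1) * (θ + 1 / R) := by
      have hexp : (3 / ρ ^ 2 + 1) * (θ + 1 / R)
          = (3 * θ / ρ ^ 2 + 1 / R) + (3 / ρ ^ 2 * (1 / R) + θ) := by ring
      rw [hexp]
      have h2 : 0 ≤ 3 / ρ ^ 2 * (1 / R) + θ := by positivity
      linarith
    calc (∑ k : Fin N, |γ k|) / Real.pi * (3 * θ / ρ ^ 2 + 1 / R)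
        ≤ (∑ k : Fin N, |γ k|) / Real.pi * ((3 / ρ ^ 2 + 1) * (θ + 1 / R)) :=
          mul_le_mul_of_nonneg_left hmono hγ
      _ = (∑ k : Fin N, |γ k|) / Real.pi * (3 / ρ ^ 2 + 1) * (θ + 1 / R) := by ring
  linarith

end Summit.NavierStokesRegularity.NavierStokesRegularity.Theorems.SkeletonEquilibrium.StraightFilament
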